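import Summits.Ventures.QEC.Thresholds.PlanarThresholdConverses
import Summits.Ventures.QEC.Thresholds.BBThresholdConverses
import Literature.InformationTheory.QuantumCodes.CSSPhenomenologicalConverse
import HarnessLib

/-!
# Phenomenological threshold CEILINGS for the census families (every space-time decoder, every schedule of
# rounds `T_i ≥ 1`): `p₀ ≤ 1/2`, `p₀^Z + p₀^X ≤ 1/2`, `≤ (1 − R)/2`; toric / planar `p₀(5) ≤ p_c^ph ≤ 1/4`;
# `[[72,12,6]]`, `[[144,12,12]]`: `1/4 ≤ P^ph_{1/4}`

Venture QEC, `Summits/Ventures/QEC/Thresholds/` (LADDER-QEC rung Q5; qec-lit-2 gen 4). HONEST FRAMING. The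
phenomenological rows of the census (`zPhenomFailureFamily`, `xPhenomFailureFamily` of `CSSFamilyThresholds.lean`:
isotropic `q = p`, perfect closing round, space-time decoders) so far carried only certified FLOORS (`p₀(w+1)`,
Dumer–Kovalev–Pryadko `w → w + 2`). `Literature/…/CSSPhenomenologicalConverse.lean` PROVES the genie comparison
`P_{2p}[erasure uncorrectable] ≤ 2 · P^ph_{p,p}[D]` for EVERY space-time decoder and every `T ≥ 1` (reveal all faults
but one round's qubit faults; the record sees them only through their syndrome), so every code-capacity ceiling
has a phenomenological twin. Packaging:

* every census family with `k ≥ 1`, rounds `T_i ≥ 1`, ANY space-time decoder families: `a ≤ 1/2`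
  (`phenomThreshold_le_half`), `a + b ≤ 1/2` (`phenomThreshold_sum_le_half`), `a + b ≤ (1 − R)/2` at rate `≥ R`
  (`phenomThreshold_sum_le_half_sub_rate`), accuracy-threshold forms;
* **toric codes**: `p_c^{ph} ≤ 1/4` for EVERY space-time decoder family, either sector
  (`toricHGP_z_phenom_threshold_le_quarter`, `…_x_…`); with the floor: **`p₀(5) ≤ p_c^{ph} ≤ 1/4`** under
  minimum-weight space-time decoding and polynomially many rounds (`toricHGP_z_phenom_accuracyThreshold_mem`;
  printed value `≈ .029`–`.033` by simulation — VALIDATED column, not a theorem);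
* **planar surface codes**: the same (`planar_phenom_threshold_le_quarter`, `planar_phenom_accuracyThreshold_mem`);
* **`[[72,12,6]]`, `[[144,12,12]]`**, every space-time decoder, every `T ≥ 1`, either sector: `1/4 ≤ P^ph_{1/4,1/4}`
  (`bb72_quarter_le_zPhenom_quarter`, …) and `1/2 ≤ P^ph_{1/2,1/2}`.

Kernel axioms only; no named fact; no `native_decide`; no new definition.

## References

* [DennisEtAl2002] E. Dennis, A. Kitaev, A. Landahl, J. Preskill, J. Math. Phys. 43 (2002) 4452, §4.2–4.3, §5.2–5.3
  (phenomenological model, `p = q`), §4.6 (`p_c`).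
* [RichardsonUrbanke2008] T. Richardson, R. Urbanke, *Modern Coding Theory*, Lemma 4.78 (Erasure Decomposition).
* [StaceBarrettDoherty2009] T. M. Stace, S. D. Barrett, A. C. Doherty, PRL 102 (2009) 200501, p. 2.
* [DumerKovalevPryadko2015] I. Dumer, A. A. Kovalev, L. P. Pryadko, PRL 115 (2015) 050502, Thm 3, p. 5.
* [BravyiEtAl2024] S. Bravyi et al., Nature 627 (2024) 778, Table 1.
-/

noncomputable section

namespace Summit.Ventures.QEC.Thresholds

open Filter Topology Finset Matrix
open Literature.InformationTheory.QuantumCodes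
open Literature.InformationTheory.QuantumCodes.CSSPhenom

/-! ### Every census family -/

section Families

variable {RX RZ Q : ℕ → Type*} [∀ i, Fintype (Q i)] [∀ i, DecidableEq (Q i)] [∀ i, Fintype (RX i)]
  [∀ i, DecidableEq (RX i)] [∀ i, Fintype (RZ i)] [∀ i, DecidableEq (RZ i)]

omit [∀ i, DecidableEq (RZ i)] in
/-- **Phenomenological threshold `≤ 1/2`** for every census family with `k ≥ 1`, rounds `T_i ≥ 1`, and EVERY
space-time decoder family (`Z`-sector). [cite: DennisEtAl2002, §4.6 (p_c) and §5.3 (p = q)] -/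
theorem phenomThreshold_le_half (C : ∀ i, CSSCode (RX i) (RZ i) (Q i)) (hk : ∀ i, 0 < (C i).k) (T : ℕ → ℕ)
    (hT : ∀ i, 0 < T i) (DZ : ∀ i, STDecoder (RX i) (Q i) (T i)) {a : ℝ}
    (ha : IsThresholdLowerBound (zPhenomFailureFamily C T DZ) a) : a ≤ 1 / 2 :=
  phenom_threshold_le_half C hk T hT DZ ha

/-- **`p₀^{ph,Z} + p₀^{ph,X} ≤ 1/2`**: certified phenomenological threshold lower bounds of the two sectors of a
census family with `k ≥ 1` (rounds `T_i, T'_i ≥ 1`, ANY space-time decoder families) sum to at most `1/2`.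
[cite: DennisEtAl2002, §4.6 and §5.3; StaceBarrettDoherty2009, p. 2 (no-cloning bound)] -/
theorem phenomThreshold_sum_le_half (C : ∀ i, CSSCode (RX i) (RZ i) (Q i)) (hk : ∀ i, 0 < (C i).k)
    (T T' : ℕ → ℕ) (hT : ∀ i, 0 < T i) (hT' : ∀ i, 0 < T' i) (DZ : ∀ i, STDecoder (RX i) (Q i) (T i))
    (DX : ∀ i, STDecoder (RZ i) (Q i) (T' i)) {a b : ℝ}
    (ha : IsThresholdLowerBound (zPhenomFailureFamily C T DZ) a)
    (hb : IsThresholdLowerBound (xPhenomFailureFamily C T' DX) b) : a + b ≤ 1 / 2 :=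
  phenom_thresholds_add_le_half C hk T T' hT hT' DZ DX ha hb

/-- Accuracy-threshold form: `p_c^{ph,Z} + p_c^{ph,X} ≤ 1/2`. [cite: DennisEtAl2002, §4.6 (p_c) and §5.3] -/
theorem phenomAccuracyThreshold_sum_le_half (C : ∀ i, CSSCode (RX i) (RZ i) (Q i)) (hk : ∀ i, 0 < (C i).k)
    (T T' : ℕ → ℕ) (hT : ∀ i, 0 < T i) (hT' : ∀ i, 0 < T' i) (DZ : ∀ i, STDecoder (RX i) (Q i) (T i))
    (DX : ∀ i, STDecoder (RZ i) (Q i) (T' i)) :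
    accuracyThreshold (zPhenomFailureFamily C T DZ) + accuracyThreshold (xPhenomFailureFamily C T' DX) ≤ 1 / 2 :=
  phenom_accuracyThresholds_add_le_half C hk T T' hT hT' DZ DX

/-- **Rate tradeoff**: at rate `≥ R` (`R n_i ≤ k_i`) the two sectors' certified phenomenological threshold lower
bounds satisfy `a + b ≤ (1 − R)/2`, ANY space-time decoders. [cite: BennettDivincenzoSmolin1997, p. 3218 (Q ≤ 1 − 2ε); DennisEtAl2002, §4.6 and §5.3] -/
theorem phenomThreshold_sum_le_half_sub_rate (C : ∀ i, CSSCode (RX i) (RZ i) (Q i)) (hk : ∀ i, 0 < (C i).k)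
    {R : ℝ} (hR : ∀ i, R * Fintype.card (Q i) ≤ (C i).k) (T T' : ℕ → ℕ) (hT : ∀ i, 0 < T i)
    (hT' : ∀ i, 0 < T' i) (DZ : ∀ i, STDecoder (RX i) (Q i) (T i)) (DX : ∀ i, STDecoder (RZ i) (Q i) (T' i))
    {a b : ℝ} (ha : IsThresholdLowerBound (zPhenomFailureFamily C T DZ) a)
    (hb : IsThresholdLowerBound (xPhenomFailureFamily C T' DX) b) : a + b ≤ (1 - R) / 2 :=
  phenom_thresholds_add_le_half_sub_rate C hk hR T T' hT hT' DZ DX ha hb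

/-- Accuracy-threshold form of the rate tradeoff: `p_c^{ph,Z} + p_c^{ph,X} ≤ (1 − R)/2`.
[cite: BennettDivincenzoSmolin1997, p. 3218 (Q ≤ 1 − 2ε); DennisEtAl2002, §4.6 (p_c)] -/
theorem phenomAccuracyThreshold_sum_le_half_sub_rate (C : ∀ i, CSSCode (RX i) (RZ i) (Q i))
    (hk : ∀ i, 0 < (C i).k) {R : ℝ} (hR : ∀ i, R * Fintype.card (Q i) ≤ (C i).k) (T T' : ℕ → ℕ)
    (hT : ∀ i, 0 < T i) (hT' : ∀ i, 0 < T' i) (DZ : ∀ i, STDecoder (RX i) (Q i) (T i))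
    (DX : ∀ i, STDecoder (RZ i) (Q i) (T' i)) :
    accuracyThreshold (zPhenomFailureFamily C T DZ) + accuracyThreshold (xPhenomFailureFamily C T' DX)
      ≤ (1 - R) / 2 :=
  phenom_accuracyThresholds_add_le_half_sub_rate C hk hR T T' hT hT' DZ DX

end Families

/-! ### Toric codes: `p₀(5) ≤ p_c^{ph} ≤ 1/4` -/

section Toric

/-- **Toric phenomenological threshold `≤ 1/4` for EVERY space-time decoder family** (`Z`-sector, every schedule
of rounds `T_k ≥ 1`): the two sectors have the same erasure behaviour, so `1/4 ≤ P^{ph}_{1/4}` throughout.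
[cite: DennisEtAl2002, §4.6 and §5.3; StaceBarrettDoherty2009, p. 2] -/
theorem toricHGP_z_phenom_threshold_le_quarter {T : ℕ → ℕ} (hT : ∀ k, 0 < T k)
    (D : ∀ k, STDecoder (Fin (k + 2) × Fin (k + 2)) ((Fin (k + 2) × Fin (k + 2)) ⊕ (Fin (k + 2) × Fin (k + 2))) (T k))
    {a : ℝ} (ha : IsThresholdLowerBound (zPhenomFailureFamily (fun k => toricHGPCode k) T D) a) : a ≤ 1 / 4 :=
  phenom_threshold_le_quarter_of_symm (fun k => toricHGPCode k) toricHGPCode_k_pos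
    (fun k y => toricHGP_xErasureFamily_eq k y) T hT D ha

/-- **Toric phenomenological threshold `≤ 1/4` for EVERY space-time decoder family**, `X`-sector.
[cite: DennisEtAl2002, §4.6 and §5.3; StaceBarrettDoherty2009, p. 2] -/
theorem toricHGP_x_phenom_threshold_le_quarter {T : ℕ → ℕ} (hT : ∀ k, 0 < T k)
    (D : ∀ k, STDecoder (Fin (k + 2) × Fin (k + 2)) ((Fin (k + 2) × Fin (k + 2)) ⊕ (Fin (k + 2) × Fin (k + 2))) (T k))
    {a : ℝ} (ha : IsThresholdLowerBound (xPhenomFailureFamily (fun k => toricHGPCode k) T D) a) : a ≤ 1 / 4 :=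
  phenom_threshold_le_quarter_of_symm (fun k => (toricHGPCode k).swap)
    (fun k => by rw [CSSCode.k_swap]; exact toricHGPCode_k_pos k)
    (fun k y => (toricHGP_xErasureFamily_eq k y).symm) T hT D ha

/-- **`p₀(5) ≤ p_c^{ph} ≤ 1/4` for the toric codes** (`Z`-sector): polynomially bounded rounds `T_k ≥ 1`, any
minimum-weight space-time decoder family for the floor, the ceiling for every decoder (`p₀(5) = (5-2√6)/10 ≈ .0101`).
[cite: DumerKovalevPryadko2015, Thm 3 and p. 5; DennisEtAl2002, §4.6 and §5.3] -/
theorem toricHGP_z_phenom_accuracyThreshold_mem {T : ℕ → ℕ} (hT : ToricCode.IsPolyBounded T)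
    (hT1 : ∀ k, 0 < T k)
    (D : ∀ k, STDecoder (Fin (k + 2) × Fin (k + 2)) ((Fin (k + 2) × Fin (k + 2)) ⊕ (Fin (k + 2) × Fin (k + 2))) (T k))
    (hD : ∀ k, (D k).IsMinWeight (stSyn (toricHGPCode k).HX (T k)) (stCycles (toricHGPCode k).HX (T k)) hammingNorm) :
    thresholdValue 5 ≤ accuracyThreshold (zPhenomFailureFamily (fun k => toricHGPCode k) T D) ∧
      accuracyThreshold (zPhenomFailureFamily (fun k => toricHGPCode k) T D) ≤ 1 / 4 :=
  ⟨le_accuracyThreshold (toricHGP_z_phenom_isThresholdLowerBound hT D hD)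
      ((thresholdValue_le_half 5).trans (by norm_num)),
    toricHGP_z_phenom_threshold_le_quarter hT1 D (isThresholdLowerBound_accuracyThreshold _)⟩

/-- Accuracy-threshold form, every space-time decoder family: `p_c^{ph,Z} ≤ 1/4` for the toric codes.
[cite: DennisEtAl2002, §4.6 and §5.3] -/
theorem toricHGP_z_phenom_accuracyThreshold_le_quarter {T : ℕ → ℕ} (hT : ∀ k, 0 < T k)
    (D : ∀ k, STDecoder (Fin (k + 2) × Fin (k + 2)) ((Fin (k + 2) × Fin (k + 2)) ⊕ (Fin (k + 2) × Fin (k + 2))) (T k)) :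
    accuracyThreshold (zPhenomFailureFamily (fun k => toricHGPCode k) T D) ≤ 1 / 4 :=
  toricHGP_z_phenom_threshold_le_quarter hT D (isThresholdLowerBound_accuracyThreshold _)

/-- Accuracy-threshold form, `X`-sector: `p_c^{ph,X} ≤ 1/4` for the toric codes.
[cite: DennisEtAl2002, §4.6 and §5.3] -/
theorem toricHGP_x_phenom_accuracyThreshold_le_quarter {T : ℕ → ℕ} (hT : ∀ k, 0 < T k)
    (D : ∀ k, STDecoder (Fin (k + 2) × Fin (k + 2)) ((Fin (k + 2) × Fin (k + 2)) ⊕ (Fin (k + 2) × Fin (k + 2))) (T k)) :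
    accuracyThreshold (xPhenomFailureFamily (fun k => toricHGPCode k) T D) ≤ 1 / 4 :=
  toricHGP_x_phenom_threshold_le_quarter hT D (isThresholdLowerBound_accuracyThreshold _)

end Toric

/-! ### Planar surface codes: `p₀(5) ≤ p_c^{ph} ≤ 1/4` -/

section Planar

/-- The census phenomenological family of the planar codes IS lit-2's `planarPhenomFailureFamily` (definitional).
[cite: DennisEtAl2002, §5.2 (Prob_fail)] -/
theorem zPhenomFailureFamily_planarHGPCode (T : ℕ → ℕ)
    (D : ∀ k, STDecoder (PlanarCheck k) (PlanarQubit k) (T k)) :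
    zPhenomFailureFamily (fun k => planarHGPCode k) T D = planarPhenomFailureFamily T D := rfl

/-- Second sector (definitional). [cite: DennisEtAl2002, §5.2 (Prob_fail)] -/
theorem xPhenomFailureFamily_planarHGPCode (T : ℕ → ℕ)
    (D : ∀ k, STDecoder (PlanarZCheck k) (PlanarQubit k) (T k)) :
    xPhenomFailureFamily (fun k => planarHGPCode k) T D = planarPhenomFailureFamily' T D := rfl

/-- **Planar phenomenological threshold `≤ 1/4` for EVERY space-time decoder family** (first sector, rounds
`T_k ≥ 1`). [cite: DennisEtAl2002, §4.6 and §5.3; StaceBarrettDoherty2009, p. 2] -/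
theorem planar_phenom_threshold_le_quarter {T : ℕ → ℕ} (hT : ∀ k, 0 < T k)
    (D : ∀ k, STDecoder (PlanarCheck k) (PlanarQubit k) (T k)) {a : ℝ}
    (ha : IsThresholdLowerBound (planarPhenomFailureFamily T D) a) : a ≤ 1 / 4 :=
  phenom_threshold_le_quarter_of_symm (fun k => planarHGPCode k) planarHGPCode_k_pos
    (fun k y => planar_xErasureFamily_eq k y) T hT D ha

/-- **Planar phenomenological threshold `≤ 1/4` for EVERY space-time decoder family**, second sector.
[cite: DennisEtAl2002, §4.6 and §5.3; StaceBarrettDoherty2009, p. 2] -/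
theorem planar_phenom_threshold_le_quarter' {T : ℕ → ℕ} (hT : ∀ k, 0 < T k)
    (D : ∀ k, STDecoder (PlanarZCheck k) (PlanarQubit k) (T k)) {a : ℝ}
    (ha : IsThresholdLowerBound (planarPhenomFailureFamily' T D) a) : a ≤ 1 / 4 :=
  phenom_threshold_le_quarter_of_symm (fun k => (planarHGPCode k).swap)
    (fun k => by rw [CSSCode.k_swap]; exact planarHGPCode_k_pos k)
    (fun k y => (planar_xErasureFamily_eq k y).symm) T hT D ha

/-- **`p₀(5) ≤ p_c^{ph} ≤ 1/4` for the planar surface codes** (first sector): polynomially bounded rounds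
`T_k ≥ 1`, minimum-weight space-time decoding for the floor, the ceiling for every decoder.
[cite: DumerKovalevPryadko2015, Thm 3 and p. 5; DennisEtAl2002, §4.6 and §5.3] -/
theorem planar_phenom_accuracyThreshold_mem {T : ℕ → ℕ} (hT : ToricCode.IsPolyBounded T) (hT1 : ∀ k, 0 < T k)
    {D : ∀ k, STDecoder (PlanarCheck k) (PlanarQubit k) (T k)}
    (hD : ∀ k, (D k).IsMinWeight (stSyn (planarHX k) (T k)) (stCycles (planarHX k) (T k)) hammingNorm) :
    thresholdValue 5 ≤ accuracyThreshold (planarPhenomFailureFamily T D) ∧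
      accuracyThreshold (planarPhenomFailureFamily T D) ≤ 1 / 4 :=
  ⟨le_accuracyThreshold (planar_phenom_isThresholdLowerBound hT hD) ((thresholdValue_le_half 5).trans (by norm_num)),
    planar_phenom_threshold_le_quarter hT1 D (isThresholdLowerBound_accuracyThreshold _)⟩

/-- Accuracy-threshold form, every space-time decoder family (first sector): `p_c^{ph} ≤ 1/4`.
[cite: DennisEtAl2002, §4.6 and §5.3] -/
theorem planar_phenom_accuracyThreshold_le_quarter {T : ℕ → ℕ} (hT : ∀ k, 0 < T k)
    (D : ∀ k, STDecoder (PlanarCheck k) (PlanarQubit k) (T k)) :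
    accuracyThreshold (planarPhenomFailureFamily T D) ≤ 1 / 4 :=
  planar_phenom_threshold_le_quarter hT D (isThresholdLowerBound_accuracyThreshold _)

/-- Accuracy-threshold form, second sector. [cite: DennisEtAl2002, §4.6 and §5.3] -/
theorem planar_phenom_accuracyThreshold_le_quarter' {T : ℕ → ℕ} (hT : ∀ k, 0 < T k)
    (D : ∀ k, STDecoder (PlanarZCheck k) (PlanarQubit k) (T k)) :
    accuracyThreshold (planarPhenomFailureFamily' T D) ≤ 1 / 4 :=
  planar_phenom_threshold_le_quarter' hT D (isThresholdLowerBound_accuracyThreshold _)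

end Planar

/-! ### `[[72,12,6]]` and `[[144,12,12]]`: every space-time decoder fails with probability `≥ 1/4` at `p = q = 1/4` -/

section BB

/-- **`[[72,12,6]]`, phenomenological noise `p = q = 1/4`, `Z`-sector**: every space-time decoder, for every
number of rounds `T ≥ 1`, fails with probability `≥ 1/4`. [cite: DennisEtAl2002, §5.2–5.3; BravyiEtAl2024, Table 1 row [[72,12,6]]] -/
theorem bb72_quarter_le_zPhenom_quarter {T : ℕ} (hT : 0 < T) (D : STDecoder (BB.Mono 6 6) (BB.Mono 6 6 ⊕ BB.Mono 6 6) T) :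
    1 / 4 ≤ phenomFailureProb BB.bb72.HX T (BB.bb72.css.rowSpZ : Set (BB.Mono 6 6 ⊕ BB.Mono 6 6 → ZMod 2)) D
      (1 / 4) (1 / 4) :=
  BB.bb72.css.quarter_le_zPhenom_quarter_of_symm bb72_css_k_pos (fun y => bb72_xUncorrectableProb_eq y) D ⟨0, hT⟩

/-- **`[[72,12,6]]`, `p = q = 1/4`, `X`-sector**: every space-time decoder fails with probability `≥ 1/4`.
[cite: DennisEtAl2002, §5.2–5.3; BravyiEtAl2024, Table 1 row [[72,12,6]]] -/
theorem bb72_quarter_le_xPhenom_quarter {T : ℕ} (hT : 0 < T) (D : STDecoder (BB.Mono 6 6) (BB.Mono 6 6 ⊕ BB.Mono 6 6) T) :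
    1 / 4 ≤ phenomFailureProb BB.bb72.HZ T (BB.bb72.css.rowSpX : Set (BB.Mono 6 6 ⊕ BB.Mono 6 6 → ZMod 2)) D
      (1 / 4) (1 / 4) :=
  BB.bb72.css.swap.quarter_le_zPhenom_quarter_of_symm (by rw [CSSCode.k_swap]; exact bb72_css_k_pos)
    (fun y => (bb72_xUncorrectableProb_eq y).symm) D ⟨0, hT⟩

/-- **`[[72,12,6]]`, `p = q = 1/2`**: every space-time decoder fails with probability `≥ 1/2` (`Z`-sector).
[cite: DennisEtAl2002, §5.2–5.3; BravyiEtAl2024, Table 1 row [[72,12,6]]] -/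
theorem bb72_half_le_zPhenom_half {T : ℕ} (hT : 0 < T) (D : STDecoder (BB.Mono 6 6) (BB.Mono 6 6 ⊕ BB.Mono 6 6) T) :
    1 / 2 ≤ phenomFailureProb BB.bb72.HX T (BB.bb72.css.rowSpZ : Set (BB.Mono 6 6 ⊕ BB.Mono 6 6 → ZMod 2)) D
      (1 / 2) (1 / 2) :=
  BB.bb72.css.half_le_zPhenom_half bb72_css_k_pos D ⟨0, hT⟩

/-- **`[[144,12,12]]`, phenomenological noise `p = q = 1/4`, `Z`-sector**: every space-time decoder, every
`T ≥ 1`, fails with probability `≥ 1/4`. [cite: DennisEtAl2002, §5.2–5.3; BravyiEtAl2024, Table 1 row [[144,12,12]]] -/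
theorem bb144_quarter_le_zPhenom_quarter {T : ℕ} (hT : 0 < T)
    (D : STDecoder (BB.Mono 12 6) (BB.Mono 12 6 ⊕ BB.Mono 12 6) T) :
    1 / 4 ≤ phenomFailureProb BB.bb144.HX T (BB.bb144.css.rowSpZ : Set (BB.Mono 12 6 ⊕ BB.Mono 12 6 → ZMod 2)) D
      (1 / 4) (1 / 4) :=
  BB.bb144.css.quarter_le_zPhenom_quarter_of_symm bb144_css_k_pos (fun y => bb144_xUncorrectableProb_eq y) D ⟨0, hT⟩

/-- **`[[144,12,12]]`, `p = q = 1/4`, `X`-sector**: every space-time decoder fails with probability `≥ 1/4`.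
[cite: DennisEtAl2002, §5.2–5.3; BravyiEtAl2024, Table 1 row [[144,12,12]]] -/
theorem bb144_quarter_le_xPhenom_quarter {T : ℕ} (hT : 0 < T)
    (D : STDecoder (BB.Mono 12 6) (BB.Mono 12 6 ⊕ BB.Mono 12 6) T) :
    1 / 4 ≤ phenomFailureProb BB.bb144.HZ T (BB.bb144.css.rowSpX : Set (BB.Mono 12 6 ⊕ BB.Mono 12 6 → ZMod 2)) D
      (1 / 4) (1 / 4) :=
  BB.bb144.css.swap.quarter_le_zPhenom_quarter_of_symm (by rw [CSSCode.k_swap]; exact bb144_css_k_pos)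
    (fun y => (bb144_xUncorrectableProb_eq y).symm) D ⟨0, hT⟩

/-- **`[[144,12,12]]`, `p = q = 1/2`**: every space-time decoder fails with probability `≥ 1/2` (`Z`-sector).
[cite: DennisEtAl2002, §5.2–5.3; BravyiEtAl2024, Table 1 row [[144,12,12]]] -/
theorem bb144_half_le_zPhenom_half {T : ℕ} (hT : 0 < T)
    (D : STDecoder (BB.Mono 12 6) (BB.Mono 12 6 ⊕ BB.Mono 12 6) T) :
    1 / 2 ≤ phenomFailureProb BB.bb144.HX T (BB.bb144.css.rowSpZ : Set (BB.Mono 12 6 ⊕ BB.Mono 12 6 → ZMod 2)) D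
      (1 / 2) (1 / 2) :=
  BB.bb144.css.half_le_zPhenom_half bb144_css_k_pos D ⟨0, hT⟩

end BB

end Summit.Ventures.QEC.Thresholds
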